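import Literature.MathematicalPhysics.QuantumManyBody.LiebYngvasonLowerBound
import HarnessLib

/-!
# Condensation of the dilute Bose gas on NEUMANN boxes beyond the Gross–Pitaevskii scale

Topic `Literature/MathematicalPhysics/QuantumManyBody`, namespace `…BoseGas` (cite item wi-11632;
companion of the periodic-box theorem `Fournais2020_condensation`, file `PeriodicBoseGas.lean`;
wanted by route `AtomisticToContinuum/BECVortexSheetDuality`, crux `HealingScaleTransfer`, whose
localisation of a torus near-minimiser into cells of Fournais side produces NEUMANN-type cell
states, to which the periodic theorem does not apply verbatim).

Carriers (all real definitions of the tree, units `ħ = 2m = 1`): the Neumann `N`-body box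
`Λ_L^N = (0,L)^{3N}` (`boxN`), Neumann trial states `NeumannTrialState N L` (`C¹`, normalised on
the box, no boundary condition = the form domain of the Neumann realisation), the Neumann energy
`neumannEnergy v Ψ = ∫_{Λ_L^N} |∇Ψ|² + ∑_{i<j} v(|xᵢ-xⱼ|)|Ψ|²` (`LiebYngvasonLowerBound.lean`), the
scattering length `scatteringLength v` and the expected number of condensed particles
`condensateOccupation N L Ψ = ⟨Ψ, n₀ Ψ⟩` in the constant mode `L^{-3/2} 1_{[0,L)³}`
(`PeriodicBoseGas.lean`; `⟨Ψ, n₊Ψ⟩ = N − ⟨Ψ, n₀Ψ⟩` is written additively, exactly as in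
`Fournais2020_condensation`; the half-open cell `[0,L)³` and the open box `(0,L)³` differ by a
Lebesgue-null set).

## Source and what is vendored

L. Junge, *Propagation of condensation via Neumann localization in the dilute Bose gas*,
arXiv:2603.20776 (2026), §"Application to the dilute Bose gas" (pp. 5–6, read): `H_N = ∑ −Δᵢ +
∑_{i<j} v(xᵢ−xⱼ)` on `L²([0,L]^{3N})` with NEUMANN boundary conditions, `ρ = N/L³`,
`n₊ = ∑ᵢ Qᵢ` with `Q` the projection orthogonal to the constants ((19)–(21)), and

* **Theorem 4** (established in Fournais–Junge–Girardot–Morin–Olivieri–Triay, arXiv:2408.14222 =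
  Ann. Henri Poincaré 2026, the pinned form of their Thm. 1.3): "Let `v ≥ 0` be radially
  decreasing and compactly supported, then there exist `C, η > 0` such that for
  `L = a(ρa³)^{−1/2−η}` and `T ≤ ρa(ρa³)^{−η}` we have
  `−T log Tr e^{−β(H_N − η n₊/L²)} ≥ 4πρaN(1 + (128/(15√π))√(ρa³) − C(ρa³)^{1/2+η})
   + L³ T^{5/2} (2π)^{−3} ∫ log(1 − e^{−√(p⁴+16πp²ρa/T)}) dp`" (23);
* eq. (25): for the Gibbs state, `Tr(n₊Γ₀) ≤ C L² N ρa(ρa³)^{1/2+η} ≤ C N (ρa³)^{1/2−η}`, and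
  **Corollary 6**: the same weak condensation bound `≤ C N ρ R² a (ρa³)^{1/2+η}` on larger Neumann
  boxes `R ≥ a(ρa³)^{−1/2−η}` (via the Neumann localisation Thm. 3).

The tree has no Gibbs states, traces or temperature, so we vendor the **zero-temperature content
of Theorem 4** — at `T = 0` the free energy of `H_N − η n₊/L²` is the bottom of its spectrum, i.e.
the infimum of its quadratic form over normalised states in the Neumann form domain, and the
thermal integral vanishes — as the NAMED FACT `Junge2026_neumannBox_pinnedLowerBound` (D-0014):
for every normalised BOSE-SYMMETRIC Neumann state `Ψ` on the box of side `L = a(ρa³)^{−1/2−η}`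
(symmetry as an explicit hypothesis, `NeumannTrialState` carrying none; both sources act on
`L²_sym(Λ^N)`),
`⟨Ψ, H_N Ψ⟩ − (η/L²)⟨Ψ, n₊Ψ⟩ ≥ 4πρaN(1 + (128/(15√π))√(ρa³) − C(ρa³)^{1/2+η})`,
in the additive `ℝ≥0∞` form `RHS + (η/L²)·N ≤ ⟨Ψ,HΨ⟩ + (η/L²)·⟨Ψ,n₀Ψ⟩`, in the dilute regime
`ρa³ ≤ c` of the paper. From it we PROVE the zero-temperature analogue of (25) for
near-minimisers, `Junge2026_neumannBox_pinnedLowerBound.condensation`: if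
`⟨Ψ,HΨ⟩ ≤ 4πρaN(1 + (128/(15√π))√(ρa³)) + C₀ρaN(ρa³)^{1/2+η}` then
`N ≤ ⟨Ψ,n₀Ψ⟩ + C' ρ a L² (ρa³)^{1/2+η} N` with `C' = (4πC + C₀)/η` — the Neumann counterpart of
`Fournais2020_condensation` (there `L = C_L(ρa³)^{−δ}(ρa)^{−1/2}`, error `CρaL²(ρa³)^{1/2−ε}N`).

## Not vendored

Positive temperature (free energy, Gibbs states, the thermal integral of (23)); Corollary 6 on
boxes `R > L` (needs Junge's Neumann localisation Thm. 1/3 with the discrete Neumann Laplacian on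
the lattice of boxes); the thermodynamic-limit free energy FGJMOT Thm. 1.1; particle numbers other
than `N = ρL³` with `L` tied to `ρ` (FGJMOT Thm. 1.3 allows `n ≤ 20ρℓ³` but prints no pinning term).

## References

* [Junge2026] L. Junge, arXiv:2603.20776, Thm. 3, Thm. 4, Rem. 5, eq. (25), Cor. 6.
* [FournaisEtAl2024] S. Fournais, L. Junge, T. Girardot, L. Morin, M. Olivieri, A. Triay, The free
  energy of dilute Bose gases at low temperatures interacting via strong potentials,
  arXiv:2408.14222, Ann. Henri Poincaré (2026) doi:10.1007/s00023-026-01676-1, Thm. 1.3.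
* [Fournais2020] S. Fournais, Length scales for BEC in the dilute Bose gas, Thm. 1.2.
-/

noncomputable section

open scoped ENNReal NNReal
open MeasureTheory

namespace Literature.MathematicalPhysics.QuantumManyBody.BoseGas

/-- **Junge 2026, Theorem 4 at zero temperature (Neumann box, pinned lower bound).** Let the pair
potential profile `v ≥ 0` be radially non-increasing and of finite range (hard cores allowed), with
scattering length `0 < a < ∞`. Then there are `C, η, c > 0` such that for all `N ≥ 1`, `L > 0` with
`ρ := N/L³`, `ρa³ ≤ c` and `L = a(ρa³)^{−1/2−η}`, every normalised BOSE-SYMMETRIC Neumann state `Ψ`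
on `Λ_L^N` (the sources work on the bosonic space `L²_sym(Λ^N)`; symmetry is a hypothesis here since
`NeumannTrialState` carries none, and it is what makes `N·⟨Ψ, P₁Ψ⟩ = ⟨Ψ, n₀Ψ⟩` for
`condensateOccupation`) satisfies `⟨Ψ, H_N Ψ⟩ − (η/L²)⟨Ψ, n₊Ψ⟩ ≥ 4πρaN(1 + (128/(15√π))√(ρa³) − C(ρa³)^{1/2+η})`
(printed for the free energy of `H_N − η n₊/L²` at `T ≤ ρa(ρa³)^{−η}`, eq. (23); at `T = 0` the free
energy is the bottom of the spectrum = the infimum of the quadratic form, and the thermal term of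
(23) vanishes). Written additively in `ℝ≥0∞` with `⟨Ψ, n₊Ψ⟩ = N − ⟨Ψ, n₀Ψ⟩`,
`⟨Ψ, n₀Ψ⟩ = condensateOccupation N L Ψ`; the dilute-regime restriction `ρa³ ≤ c` and the
dependence of `C, η, c` on `v` are as in the paper. SOURCE STATUS: the pinned form (with `−η n₊/L²`)
is printed only in Junge's preprint, Thm. 4 ("In [4] the following result was established"), as his
restatement of the proof of Fournais–Junge–Girardot–Morin–Olivieri–Triay, arXiv:2408.14222 = Ann.
Henri Poincaré (2026), whose published Thm. 1.3 (read) is on `L²_sym(Λ^N)`, requires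
`0 < η < 1/1026` and support radius `R ≤ C₀a` (with `C = C(C₀)`), allows `0 ≤ T`, and prints NO
pinning term. Locator: Junge 2026, Thm. 4, eq. (23), at `T = 0`.
[claim: Junge2026, status: under-review] -/
def Junge2026_neumannBox_pinnedLowerBound : Prop :=
  ∀ (v : ℝ → ℝ≥0∞), IsRepulsiveFiniteRange v → AntitoneOn v (Set.Ici 0) →
    scatteringLength v ≠ ⊤ → 0 < scatteringLength v →
  ∃ C η c : ℝ, 0 < C ∧ 0 < η ∧ 0 < c ∧
    ∀ (N : ℕ) (L : ℝ), 0 < N → 0 < L →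
      let a := (scatteringLength v).toReal
      let ρ := (N : ℝ) / L ^ 3
      ρ * a ^ 3 ≤ c →
      L = a * (ρ * a ^ 3) ^ (-(1 / 2 + η)) →
      ∀ Ψ : NeumannTrialState N L,
        (∀ (σ : Equiv.Perm (Fin N)) (X : Config N), Ψ.ψ (X ∘ σ) = Ψ.ψ X) →
        ENNReal.ofReal (4 * Real.pi * ρ * a * N *
              (1 + 128 / (15 * Real.sqrt Real.pi) * Real.sqrt (ρ * a ^ 3)
                - C * (ρ * a ^ 3) ^ (1 / 2 + η)))
            + ENNReal.ofReal (η / L ^ 2) * (N : ℝ≥0∞)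
          ≤ neumannEnergy v Ψ + ENNReal.ofReal (η / L ^ 2) * condensateOccupation N L Ψ.ψ

namespace Junge2026_neumannBox_pinnedLowerBound

/-- An `ℝ≥0∞` cancellation-and-division step: from `R + k·N ≤ E + k·n₀`, `E ≤ R + S` (`R, S, k`
finite, `k ≠ 0`) conclude `N ≤ n₀ + k⁻¹·S`. [folklore] -/
theorem le_add_inv_mul_of_pinned {R S k N n₀ E : ℝ≥0∞} (hR : R ≠ ⊤) (hk0 : k ≠ 0) (hktop : k ≠ ⊤)
    (h : R + k * N ≤ E + k * n₀) (hE : E ≤ R + S) : N ≤ n₀ + k⁻¹ * S := by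
  have h1 : R + k * N ≤ R + (S + k * n₀) := by
    calc R + k * N ≤ E + k * n₀ := h
      _ ≤ (R + S) + k * n₀ := add_le_add hE le_rfl
      _ = R + (S + k * n₀) := add_assoc _ _ _
  have h2 : k * N ≤ S + k * n₀ := (ENNReal.add_le_add_iff_left hR).1 h1
  have h3 : k⁻¹ * (k * N) ≤ k⁻¹ * (S + k * n₀) := mul_le_mul' le_rfl h2
  rw [← mul_assoc, ENNReal.inv_mul_cancel hk0 hktop, one_mul, mul_add, ← mul_assoc,
    ENNReal.inv_mul_cancel hk0 hktop, one_mul] at h3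
  rw [add_comm]; exact h3

/-- **Condensation of near-minimisers on the Neumann box** (zero-temperature analogue of Junge's
eq. (25), PROVED from the pinned lower bound): with `C, η, c` from the named fact enlarged to
`C' = (4πC + C₀)/η`, every normalised Bose-symmetric Neumann state on the box
`L = a(ρa³)^{−1/2−η}` with
`⟨Ψ, H_N Ψ⟩ ≤ 4πρaN(1 + (128/(15√π))√(ρa³)) + C₀ ρaN(ρa³)^{1/2+η}` has
`⟨Ψ, n₊Ψ⟩ ≤ C' ρ a L² (ρa³)^{1/2+η} N` (`= C' N (ρa³)^{1/2−η}`), i.e.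
`N ≤ ⟨Ψ, n₀Ψ⟩ + C' ρ a L² (ρa³)^{1/2+η} N` — the Neumann counterpart of `Fournais2020_condensation`.
Locator: Junge 2026, eq. (25), at `T = 0`. [claim: Junge2026, status: under-review] -/
theorem condensation (h : Junge2026_neumannBox_pinnedLowerBound) :
    ∀ (v : ℝ → ℝ≥0∞), IsRepulsiveFiniteRange v → AntitoneOn v (Set.Ici 0) →
      scatteringLength v ≠ ⊤ → 0 < scatteringLength v →
    ∀ C₀ : ℝ, 0 ≤ C₀ →
    ∃ C η c : ℝ, 0 < C ∧ 0 < η ∧ 0 < c ∧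
      ∀ (N : ℕ) (L : ℝ), 0 < N → 0 < L →
        let a := (scatteringLength v).toReal
        let ρ := (N : ℝ) / L ^ 3
        ρ * a ^ 3 ≤ c →
        L = a * (ρ * a ^ 3) ^ (-(1 / 2 + η)) →
        ∀ Ψ : NeumannTrialState N L,
          (∀ (σ : Equiv.Perm (Fin N)) (X : Config N), Ψ.ψ (X ∘ σ) = Ψ.ψ X) →
          neumannEnergy v Ψ ≤ ENNReal.ofReal (4 * Real.pi * ρ * a * N *
                (1 + 128 / (15 * Real.sqrt Real.pi) * Real.sqrt (ρ * a ^ 3))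
              + C₀ * ρ * a * N * (ρ * a ^ 3) ^ (1 / 2 + η)) →
          (N : ℝ≥0∞) ≤ condensateOccupation N L Ψ.ψ +
              ENNReal.ofReal (C * ρ * a * L ^ 2 * (ρ * a ^ 3) ^ (1 / 2 + η) * N) := by
  intro v hv hmono hatop hapos C₀ hC₀
  obtain ⟨C, η, c, hC, hη, hc, hmain⟩ := h v hv hmono hatop hapos
  refine ⟨(4 * Real.pi * C + C₀) / η, η, c, by positivity, hη, hc, ?_⟩
  intro N L hN hL a ρ hdil hbox Ψ hsymm hE
  have hpin := hmain N L hN hL hdil hbox Ψ hsymm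
  -- names for the real quantities
  set t : ℝ := (ρ * a ^ 3) ^ (1 / 2 + η) with ht
  set R : ℝ := 4 * Real.pi * ρ * a * N *
      (1 + 128 / (15 * Real.sqrt Real.pi) * Real.sqrt (ρ * a ^ 3) - C * t) with hRdef
  set S : ℝ := 4 * Real.pi * ρ * a * N * C * t + C₀ * ρ * a * N * t with hSdef
  have hk0 : ENNReal.ofReal (η / L ^ 2) ≠ 0 := by
    rw [ne_eq, ENNReal.ofReal_eq_zero, not_le]; positivity
  have hsplit : (4 * Real.pi * ρ * a * N *
        (1 + 128 / (15 * Real.sqrt Real.pi) * Real.sqrt (ρ * a ^ 3)) + C₀ * ρ * a * N * t) =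
      R + S := by
    rw [hRdef, hSdef]; ring
  have hE' : neumannEnergy v Ψ ≤ ENNReal.ofReal R + ENNReal.ofReal S := by
    refine hE.trans ?_
    rw [hsplit]
    exact ENNReal.ofReal_add_le
  have hcore := le_add_inv_mul_of_pinned ENNReal.ofReal_ne_top hk0 ENNReal.ofReal_ne_top hpin hE'
  refine hcore.trans (le_of_eq ?_)
  congr 1
  rw [← ENNReal.ofReal_inv_of_pos (by positivity), ← ENNReal.ofReal_mul (by positivity)]
  congr 1
  rw [hSdef]
  field_simp

end Junge2026_neumannBox_pinnedLowerBound

end Literature.MathematicalPhysics.QuantumManyBody.BoseGas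

end
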